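import Mathlib
import Literature.AlgebraicGeometry.Tropical.TorusCycles
import Summits.HodgeConjecture.HodgeConjecture.Theorems.TropicalWeilObstructionTropicalWeilVanishingTransportCycles
import Summits.HodgeConjecture.HodgeConjecture.Theorems.TropicalWeilObstructionTropicalWeilVanishingIsogenyDensity
import Summits.HodgeConjecture.HodgeConjecture.Theorems.TropicalWeilObstructionGenericWeilPeriod
import HarnessLib

/-!
# Crux `TropicalWeilVanishing` (stmt-HodgeConjecture-18478) — Weil-generic periods are DENSE in the period domain (`n = 4`)

Route `TropicalWeilObstruction` of `HodgeConjecture` (Hodge NEGATION SINK `pub-hodge-tropical`; scoped exploration,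
no summit claim; nothing here bears on the Hodge conjecture and nothing here decides K1).

The any-base seed transports of the tree (`exists_weilGeneric_weilFunctional_ne_zero_of_unobstructedSeed`, p351568;
`exists_weilGeneric_calibrated_of_collinear_unobstructedSeed`, p358045) take as hypothesis that Weil-generic positive
definite `J`-commuting periods ACCUMULATE at the base period (`hacc`); so far this was discharged at the identity
(`exists_weilGeneric_mem_of_open`, p314377) and, for `n = 2`, at rational periods
(`GenericWeilPeriodTwo.exists_weilGeneric_two_mem_of_open`). Here, for `n = 4`:

* `exists_weilGeneric_mem_of_open_of_rat` — at every RATIONAL positive definite `J`-commuting period (segment to the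
  witness of `GenericWeilPeriod` at a small rational parameter; affine rational substitutions preserve algebraic
  independence, `GenericWeilPeriod.algebraicIndependent_affine`);
* `exists_weilGeneric_mem_of_open_of_posDef` — at EVERY positive definite `J`-commuting period: rational ones are
  dense there by the integral-isogeny density `exists_integral_isogeny` (`λ(FᵀF)⁻¹ ∈ U`; `(FᵀF)⁻¹ = adj/det` is
  rational, positive definite and `J`-commuting; replace `λ` by a nearby rational `λ'`).

So `hacc` holds at every base. Mathlib + tree lemmas; no definition, no named fact, no sorry.

## References

* [Zharkov2020TropicalWeil] I. Zharkov, Tropical abelian varieties, Weil classes and the Hodge conjecture,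
  arXiv:2002.02347 (2020), §2 (pp. 2–4).
* [MikhalkinZharkov2014Eigenwave] G. Mikhalkin, I. Zharkov, Tropical eigenwave and intermediate Jacobians,
  LN UMI 15 (2014), Def. 6.1.
-/

-- `Summit.HodgeConjecture.HodgeConjecture.…` is the mandated namespace (single-conjunct summit).
set_option linter.dupNamespace false

noncomputable section

open scoped BigOperators Matrix ComplexConjugate Topology
open Filter Matrix Literature.AlgebraicGeometry.Tropical

namespace Summit.HodgeConjecture.HodgeConjecture.Theorems.TropicalWeilVanishing.Phases

/-! ## §1 Weil-generic periods are dense in the period domain (`n = 4`) -/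

/-- **Weil-generic periods near a RATIONAL period (`n = 4`).** Every open set containing a positive definite
`J`-commuting `Q₀` with rational entries contains a positive definite `J`-commuting `Q` whose 16 free coordinates are
algebraically independent over `ℚ` (segment from `Q₀` to the witness of `GenericWeilPeriod` at a small rational
parameter; the n = 2 twin is `GenericWeilPeriodTwo.exists_weilGeneric_two_mem_of_open`).
[cite: Zharkov2020TropicalWeil, §2 (pp. 2–4)] -/
theorem exists_weilGeneric_mem_of_open_of_rat (Q₀ : Matrix (Fin (2 * 4)) (Fin (2 * 4)) ℝ)
    (hrat : ∃ q : Fin (2 * 4) → Fin (2 * 4) → ℚ, ∀ a b, Q₀ a b = (q a b : ℝ))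
    (hQ₀ : Q₀.PosDef) (hQ₀J : Q₀ * weilJ 4 = weilJ 4 * Q₀)
    (U : Set (Matrix (Fin (2 * 4)) (Fin (2 * 4)) ℝ)) (hU : IsOpen U) (h0 : Q₀ ∈ U) :
    ∃ Q ∈ U, Q.PosDef ∧ Q * weilJ 4 = weilJ 4 * Q ∧ IsWeilGeneric 4 Q := by
  obtain ⟨Q₁, hQ₁, hQ₁J, hgen⟩ := tropicalWeilObstruction_genericWeilPeriod_proof
  obtain ⟨q, hq⟩ := hrat
  have hcont : Continuous fun t : ℝ => Q₀ + t • (Q₁ - Q₀) :=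
    continuous_const.add (continuous_id.smul continuous_const)
  have hev : ∀ᶠ t in 𝓝 (0 : ℝ), Q₀ + t • (Q₁ - Q₀) ∈ U := by
    apply hcont.continuousAt.eventually_mem
    apply hU.mem_nhds
    simpa using h0
  obtain ⟨δ, hδ, hball⟩ := Metric.eventually_nhds_iff.1 hev
  obtain ⟨t, ht0, ht1⟩ := exists_rat_btwn (lt_min hδ one_pos)
  have ht0' : (0 : ℝ) < t := by exact_mod_cast ht0
  have htδ : (t : ℝ) < δ := lt_of_lt_of_le ht1 (min_le_left _ _)
  have ht1' : (t : ℝ) < 1 := lt_of_lt_of_le ht1 (min_le_right _ _)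
  have hdist : dist (t : ℝ) 0 < δ := by rw [Real.dist_eq, sub_zero, abs_of_pos ht0']; exact htδ
  refine ⟨Q₀ + (t : ℝ) • (Q₁ - Q₀), hball hdist, ?_, ?_, ?_⟩
  · have e : Q₀ + (t : ℝ) • (Q₁ - Q₀) = (1 - (t : ℝ)) • Q₀ + (t : ℝ) • Q₁ := by
      rw [smul_sub, sub_smul, one_smul]; abel
    rw [e]
    exact (hQ₀.smul (show (0 : ℝ) < 1 - t by linarith)).add (hQ₁.smul ht0')
  · rw [add_mul, mul_add, Matrix.smul_mul, Matrix.mul_smul, sub_mul, mul_sub, hQ₀J, hQ₁J]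
  · unfold IsWeilGeneric at hgen ⊢
    have h := GenericWeilPeriod.algebraicIndependent_affine hgen (fun _ => t)
      (fun ab => (1 - t) * q ab.1.1 ab.1.2) (fun _ => by exact_mod_cast ht0.ne')
    convert h using 1
    funext ab
    simp only [Matrix.add_apply, Matrix.smul_apply, Matrix.sub_apply, smul_eq_mul, hq, Rat.cast_mul,
      Rat.cast_sub, Rat.cast_one]
    ring

/-- **Weil-generic periods are dense**: every open set containing a positive definite `J`-commuting `Q₀` contains
a positive definite `J`-commuting Weil-generic `Q` (`n = 4`). Rational positive definite `J`-commuting periods are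
dense by the integral-isogeny density `exists_integral_isogeny` (`λ(FᵀF)⁻¹ ∈ U`, then a rational `λ'`), and
Weil-generic ones accumulate at rational ones. [cite: Zharkov2020TropicalWeil, §2 (pp. 2–4)]
[cite: MikhalkinZharkov2014Eigenwave, Def. 6.1] -/
theorem exists_weilGeneric_mem_of_open_of_posDef (Q₀ : Matrix (Fin (2 * 4)) (Fin (2 * 4)) ℝ)
    (hQ₀ : Q₀.PosDef) (hQ₀J : Q₀ * weilJ 4 = weilJ 4 * Q₀)
    (U : Set (Matrix (Fin (2 * 4)) (Fin (2 * 4)) ℝ)) (hU : IsOpen U) (h0 : Q₀ ∈ U) :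
    ∃ Q ∈ U, Q.PosDef ∧ Q * weilJ 4 = weilJ 4 * Q ∧ IsWeilGeneric 4 Q := by
  classical
  obtain ⟨F, lam, hFdet, hFJ, hlam, hmem⟩ := exists_integral_isogeny hQ₀ hQ₀J U hU h0
  set Fr : Matrix (Fin (2 * 4)) (Fin (2 * 4)) ℝ := F.map ((↑) : ℤ → ℝ) with hFr
  set M : Matrix (Fin (2 * 4)) (Fin (2 * 4)) ℤ := Fᵀ * F with hM
  have hMr : M.map ((↑) : ℤ → ℝ) = Frᵀ * Fr := by
    rw [hM, map_intCast_mul, Matrix.transpose_map]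
  set P : Matrix (Fin (2 * 4)) (Fin (2 * 4)) ℝ := (Frᵀ * Fr)⁻¹ with hP
  have hFrdet : Fr.det ≠ 0 := by rw [hFr, ← Int.cast_det]; exact_mod_cast hFdet
  have hFrunit : IsUnit Fr := (Matrix.isUnit_iff_isUnit_det Fr).2 (isUnit_iff_ne_zero.2 hFrdet)
  -- `FᵀF` is positive definite and commutes with `J`; so does its inverse
  have hFtF : (Frᵀ * Fr).PosDef := by
    have h := Matrix.PosDef.conjTranspose_mul_self Fr
      ((Matrix.mulVec_injective_iff_isUnit).2 hFrunit)
    rwa [Matrix.conjTranspose_eq_transpose_of_trivial] at h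
  have hPpd : P.PosDef := hFtF.inv
  have hFtJ : Frᵀ * weilJ 4 = weilJ 4 * Frᵀ := by
    have h := congrArg Matrix.transpose hFJ
    rw [Matrix.transpose_mul, Matrix.transpose_mul, TropicalWeilSupply.Negative.weilJ_transpose,
      Matrix.neg_mul, Matrix.mul_neg, neg_inj] at h
    exact h.symm
  have hMJ : (Frᵀ * Fr) * weilJ 4 = weilJ 4 * (Frᵀ * Fr) := by
    rw [Matrix.mul_assoc, hFJ, ← Matrix.mul_assoc, hFtJ, Matrix.mul_assoc]
  have hMdet : IsUnit (Frᵀ * Fr).det := (Matrix.isUnit_iff_isUnit_det _).1 hFtF.isUnit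
  have hPJ : P * weilJ 4 = weilJ 4 * P := by
    have h1 : P * ((Frᵀ * Fr) * weilJ 4) * P = P * (weilJ 4 * (Frᵀ * Fr)) * P := by rw [hMJ]
    rw [← Matrix.mul_assoc, hP, Matrix.nonsing_inv_mul _ hMdet, Matrix.one_mul, Matrix.mul_assoc,
      Matrix.mul_assoc, Matrix.mul_nonsing_inv _ hMdet, Matrix.mul_one] at h1
    exact h1.symm
  -- a rational scale `λ'` near `λ` keeps `λ' P` inside `U`
  have hcont : Continuous fun t : ℝ => t • P := continuous_id.smul continuous_const
  have hev : ∀ᶠ t in 𝓝 lam, t • P ∈ U := hcont.continuousAt.eventually_mem (hU.mem_nhds hmem)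
  obtain ⟨δ, hδ, hball⟩ := Metric.eventually_nhds_iff.1 hev
  obtain ⟨t, ht0, ht1⟩ := exists_rat_btwn (show lam < lam + δ by linarith)
  have htpos : (0 : ℝ) < t := hlam.trans ht0
  have hdist : dist (t : ℝ) lam < δ := by
    rw [Real.dist_eq, abs_of_pos (by linarith)]; linarith
  have htPU : (t : ℝ) • P ∈ U := hball hdist
  -- `t • P` is rational, positive definite, `J`-commuting
  have hrat : ∃ q : Fin (2 * 4) → Fin (2 * 4) → ℚ, ∀ a b, ((t : ℝ) • P) a b = (q a b : ℝ) := by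
    have hPdef : P = ((M.det : ℝ))⁻¹ • (M.adjugate).map ((↑) : ℤ → ℝ) := by
      rw [hP, ← hMr, Matrix.inv_def, Ring.inverse_eq_inv']
      congr 1
      · rw [Int.cast_det]
      · have h := RingHom.map_adjugate (Int.castRingHom ℝ) M
        rw [RingHom.mapMatrix_apply, RingHom.mapMatrix_apply] at h
        exact h.symm
    refine ⟨fun a b => t * ((M.det : ℚ))⁻¹ * (M.adjugate a b : ℚ), fun a b => ?_⟩
    rw [hPdef]
    simp only [Matrix.smul_apply, Matrix.map_apply, smul_eq_mul]
    rw [Rat.cast_mul, Rat.cast_mul, Rat.cast_inv, Rat.cast_intCast, Rat.cast_intCast]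
    ring
  exact exists_weilGeneric_mem_of_open_of_rat ((t : ℝ) • P) hrat (hPpd.smul htpos)
    (by rw [Matrix.smul_mul, Matrix.mul_smul, hPJ]) U hU htPU

end Summit.HodgeConjecture.HodgeConjecture.Theorems.TropicalWeilVanishing.Phases

end
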